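import Summits.QuantumFields.YangMills.Theorems.UnitScaleTiltHistoryTailIntHistoriesRows
import Summits.QuantumFields.YangMills.Theorems.UnitScaleTiltHistoryTailCoreRunRowsRows
import HarnessLib

/-!
# `UnitScaleTiltHistoryTailIntPintRows` — THE F-2b `Rows` TWIN OF ✓`UnitScaleTiltHistoryTailIntPint` OVER THE ROWS RECORD `AlphaInputsT3AC.PkgCoreRows` (✓`AlphaInputsT3ACv4CoreRows`; ★★OWNER RULING g26-№14 (F-2b),
# bill v1.2 §7, ★alpha-2 g7 checklist (s1)–(s7)) — crux `HistoryTailL` (stmt-QuantumFields-19936), cell `ym3-torus`, width seat ym-ust-19936-w6 (g2)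

WHAT.  `UnitScaleTiltHistoryTailIntPint`'s statements and proofs VERBATIM with `PkgCoreV3 ↦ PkgCoreRows` (the rows record carries the version-4 run rows `runRows : AlphaV4AC.RunAlphaV4CoreAC` — the
currency-free (71) per recorded plaquette `h71` in place of the comb (67)-row —, so `(q K).runCore ↦ (q K).runRows`, `eq71_perPlaquette_of_alphaV3Core … ↦ (q K).smallFactor71 …`,
`abs_Pint_succ_le_of_alphaV3Core ↦ AlphaV4AC.abs_Pint_succ_le_of_alphaV4Core`); declaration names `dataIntV3(P)_<row> ↦ dataIntRows(P)_<row>`, `lfDataIntV3 ↦ lfDataIntRows`, `PkgCoreV3.<row> ↦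
PkgCoreRows.<row>`, and `+Rows` on the remaining theorem names.  HONEST FRAMING.  Bookkeeping twin (renaming + one field read); nothing of [Balaban1985UV3] is proved; CONDITIONAL on
the family of rows cores exactly as the original is on its cores; the v3 original stays in the tree unchanged; count-neutral helper toward 2′χ (`--supports stmt-QuantumFields-19936`);
registry untouched.  YM₃ on the three-torus is rung R3 of the programme, not the Clay problem; no mass gap is claimed.  THE ORIGINAL'S ACCOUNT (names read with the substitutions):
# `UnitScaleTiltHistoryTailIntPintRows` — crux `HistoryTailL` (stmt-QuantumFields-19936), R-57χ successor line: STUB 2″ clauses (c) `PintSize` (`CP := C46·M₁³`) and (d) the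
# `Zterm` size (`κZ := Alf`) AT THE INTERIOR DATUM of a family of data cores — the T³ reading `PkgCoreRows.abs_Pint_succ_le` of (46) one step up for a core
# run (`…CoreRunRows`), `dataIntRows_pintSize`; `dataIntRows_Zterm_eq`/`dataIntRows_ztermSize`
# (`AlphaInputsT3ACv3Pint` §1–§2 and `AlphaInputsT3ACv3Rows` §1, ★alpha-1 g3, with `RunAlphaV3AC ↦ RunAlphaV3CoreAC`, `h.pkgAtV3 hc γ hγ hγ1 K ↦ q K`) — seat ym3-torus-p2 (g16)

Nothing of [Balaban1985UV3] is asserted; CONDITIONAL only on the core run / the family `q` (data carrying its rows).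

References: T. Bałaban, Commun. Math. Phys. 102 (1985) 255–275 [Balaban1985UV3] ((33)–(34) p.264, (41) p.266, (44)–(46) p.267, (61) p.271).
-/

set_option autoImplicit false

noncomputable section

namespace Summit.QuantumFields.YangMills.Theorems

open MeasureTheory
open scoped BigOperators
open Literature.MathematicalPhysics.QuantumFieldTheory.Balaban1983to89
open Literature.MathematicalPhysics.QuantumFieldTheory.Balaban1983to89.T3ContinuumYM3Torus
open Literature.MathematicalPhysics.QuantumFieldTheory.Balaban1983to89.T3UnitScaleTilt (θBal)
open Literature.MathematicalPhysics.QuantumFieldTheory.Balaban1983to89.T3AlphaInputsAC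
open Literature.MathematicalPhysics.QuantumFieldTheory.Balaban1983to89.B10Eq38TorusDomains (toFine)
open Literature.MathematicalPhysics.QuantumFieldTheory.Balaban1985CMP102
open Literature.MathematicalPhysics.QuantumFieldTheory.Balaban1985CMP102.Setting
open Summit.QuantumFields.Balaban3D.Carriers
open Summit.QuantumFields.Balaban3D.Proofs.Primitives
open Summit.QuantumFields.Balaban3D.Proofs.ScalesArithmetic (gk_pos gk_le_one card_site_eq)
open Summit.QuantumFields.Balaban3D.Proofs.UVStability3DInputs (adjAct)
open Summit.QuantumFields.Balaban3D.Proofs.GroupModelLieC (lieC)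
open Summit.QuantumFields.Balaban3D.Proofs.FamilyLE (thresholds_of_le)
open Summit.QuantumFields.Balaban3D.Proofs.TowerAC
open Summit.QuantumFields.Balaban3D.Proofs.StandardAC
open Summit.QuantumFields.Balaban3D.Proofs.InputsAC
open Summit.QuantumFields.Balaban3D.Proofs.AlphaAC (AlphaDataAC)
open Summit.QuantumFields.Balaban3D.Proofs.Bound46AC (abs_pint_le_stdAC)



/-! ## §2 At the T³ data core: `PintSize` for the interior datum -/

section T3

variable {F : T3Family} {𝔠 : AlphaConsts F.L (suGroupModel 2).N} {γ : ℝ} {hγ : 0 < γ} {hγ1 : γ ≤ (min 𝔠.gamma0 1) ^ 2} {K : ℕ}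

/-- **(46) FOR THE CORE'S TOWER, ONE STEP UP**: `|Pint_{k+1}(h, W)| ≤ (C46·M₁³)·θBal(K − k)²·#Ω_{k+1}^{(k+1)}(h)` for `k < K` (`g_kp(g_k) = θBal(K − k)`, `PkgCoreRows.eps1_eq`).
[cite: Balaban1985UV3, (46) p.267] -/
theorem AlphaInputsT3AC.PkgCoreRows.abs_Pint_succ_le (p : AlphaInputsT3AC.PkgCoreRows F 𝔠 γ hγ hγ1 K) (k : ℕ) (hk : k + 1 ≤ K) (h : Hist (F.P K) (k + 1))
    (W : GaugeField (F.P K) (k + 1) (Matrix.specialUnitaryGroup (Fin 2) ℂ)) :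
    |p.T.Pint (k + 1) h W| ≤ (𝔠.C46 * (𝔠.M₁ : ℝ) ^ 3) * θBal F.L γ 𝔠.b₀ 𝔠.p₀ (K - k) ^ 2 *
      (LamFin 𝔠.lane.carrier.M₁ (rcolOf (T3Scales F γ hγ (hγ1.trans (sq_min_one_le _ 𝔠.gamma0_pos)) K) 𝔠.lane.carrier) k h).card := by
  have h46 := AlphaV4AC.abs_Pint_succ_le_of_alphaV4Core (T3Scales_window F 𝔠 γ hγ hγ1 K) p.runRows k hk h W
  have hε : (T3Scales F γ hγ (hγ1.trans (sq_min_one_le _ 𝔠.gamma0_pos)) K).gk k *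
      B10.pFun 𝔠.b₀ 𝔠.p₀ ((T3Scales F γ hγ (hγ1.trans (sq_min_one_le _ 𝔠.gamma0_pos)) K).gk k) = θBal F.L γ 𝔠.b₀ 𝔠.p₀ (K - k) := by
    rw [T3Scales_gk_eq F γ hγ _ K k (by omega)]
    rfl
  rw [hε] at h46
  exact h46

variable (q : ∀ K, AlphaInputsT3AC.PkgCoreRows F 𝔠 γ hγ hγ1 K) (π : AlphaInputsT3AC.PolymerT3 F)

/-- **STUB 2″ CLAUSE (c) AT THE INTERIOR DATUM — `PintSize` PROVED, with `CP := C46·M₁³`**: for every run `K`, level `1 ≤ j ≤ K`, history `h` and field `W`,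
`|Pint^{(K)}_j(h, W)| ≤ CP·θBal(K − j + 1)²·(sitesPerDir j)³` — (46) p.267 for the package's AC tower (`PkgCoreRows.abs_Pint_succ_le`) with the volume `|Λ_j| ≤ |T^{(j)}|`; the
schema's `Adm` guard is not used. [cite: Balaban1985UV3, (46) p.267] -/
theorem AlphaInputsT3AC.dataIntRows_pintSize : PintSize (AlphaInputsT3AC.dataIntRows q π) 𝔠.b₀ 𝔠.p₀ (𝔠.C46 * (𝔠.M₁ : ℝ) ^ 3) := by
  intro K j r W hj hj1 _
  obtain ⟨k, rfl⟩ : ∃ k, j = k + 1 := ⟨j - 1, by omega⟩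
  have h46 := (q K).abs_Pint_succ_le k hj r W
  have hvol := card_lamFin_le_sitesPerDir_cube (F := F) (K := K) 𝔠.lane.carrier.M₁
    (rcolOf (T3Scales F γ hγ (hγ1.trans (sq_min_one_le _ 𝔠.gamma0_pos)) K) 𝔠.lane.carrier) k r
  have hC : 0 ≤ 𝔠.C46 * (𝔠.M₁ : ℝ) ^ 3 * θBal F.L γ 𝔠.b₀ 𝔠.p₀ (K - k) ^ 2 :=
    mul_nonneg (mul_nonneg 𝔠.C46_nonneg (pow_nonneg (Nat.cast_nonneg _) _)) (sq_nonneg _)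
  have hKk : K - (k + 1) + 1 = K - k := by omega
  show |(q K).T.Pint (k + 1) r W| ≤ _
  rw [hKk]
  exact h46.trans (mul_le_mul_of_nonneg_left hvol hC)

end T3

/-! ## §3 STUB 2″ clause (d): the size of the large-field term at the interior datum -/

section Zterm

variable {F : T3Family} {𝔠 : AlphaConsts F.L (suGroupModel 2).N} {γ : ℝ} {hγ : 0 < γ} {hγ1 : γ ≤ (min 𝔠.gamma0 1) ^ 2}
  (q : ∀ K, AlphaInputsT3AC.PkgCoreRows F 𝔠 γ hγ hγ1 K) (π : AlphaInputsT3AC.PolymerT3 F)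

/-- The interior datum's large-field term unfolded: `Zterm^{(K)}_j(h) = Σ_{i<j} zcoefOf i · |Z_i(h)|` (definitional). [cite: Balaban1985UV3, (41) p.266] -/
theorem AlphaInputsT3AC.dataIntRows_Zterm_eq (K j : ℕ) (r : Hist (F.P K) j) :
    (AlphaInputsT3AC.dataIntRows q π).Zterm K j r =
      ∑ i ∈ Finset.range j, zcoefOf (T3Scales F γ hγ (hγ1.trans (sq_min_one_le _ 𝔠.gamma0_pos)) K) 𝔠.lane.carrier i *
        (ZVol 𝔠.lane.carrier.M₁ (rcolOf (T3Scales F γ hγ (hγ1.trans (sq_min_one_le _ 𝔠.gamma0_pos)) K) 𝔠.lane.carrier) j r i : ℝ) := rfl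

/-- **STUB 2″ CLAUSE (d) AT THE INTERIOR DATUM — THE SIZE OF THE LARGE-FIELD TERM, PROVED with `κZ := 𝔠.Alf`**: for every run `K`, level `j ≤ K`, region history `r` and
fibre variable `v`, `0 ≤ Zterm_j(h) ≤ A·Σ_{i<j} (1 + log(√(γL^{−(K−i)}))⁻¹)·#{y ∈ T^{(i)} : toFine y ∉ Ω_{i+1}(h)}` with `h = assemble r v = r`,
`A = (C_z + C_v) + C₅ + C₆ + 3(|log σ₀| + d(𝔤))` — «Σ_{j<k} O(log g_j⁻¹)|Z_j|» of (41) p.266. [cite: Balaban1985UV3, (41) p.266] -/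
theorem AlphaInputsT3AC.dataIntRows_ztermSize (K j : ℕ) (r : (AlphaInputsT3AC.lfDataIntRows q π).Reg K j)
    (v : (i : Fin j) → GaugeField (F.P K) i (Matrix.specialUnitaryGroup (Fin 2) ℂ)) (hj : j ≤ K) :
    0 ≤ (AlphaInputsT3AC.dataIntRows q π).Zterm K j ((AlphaInputsT3AC.lfDataIntRows q π).assemble K j r v) ∧
    (AlphaInputsT3AC.dataIntRows q π).Zterm K j ((AlphaInputsT3AC.lfDataIntRows q π).assemble K j r v) ≤
      𝔠.Alf * ∑ i ∈ Finset.range j,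
        (1 + Real.log (Real.sqrt (γ * ((F.L : ℝ)⁻¹) ^ (K - i)))⁻¹) *
          (({y : Site (F.P K) i | toFine i y ∉ (AlphaInputsT3AC.dataIntRows q π).Ω K j
              ((AlphaInputsT3AC.lfDataIntRows q π).assemble K j r v) (i + 1)} : Set (Site (F.P K) i)).ncard : ℝ) := by
  have hγ1' : γ ≤ 1 := hγ1.trans (sq_min_one_le _ 𝔠.gamma0_pos)
  rw [AlphaInputsT3AC.lfDataIntRows_assemble_eq q π, AlphaInputsT3AC.dataIntRows_Zterm_eq q π, Finset.mul_sum]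
  refine ⟨Finset.sum_nonneg fun i hi => ?_, Finset.sum_le_sum fun i hi => ?_⟩
  · have hiK : i ≤ K := (Finset.mem_range.mp hi).le.trans hj
    exact mul_nonneg (𝔠.zcoefOf_nonneg_le (T3Scales F γ hγ hγ1' K) i hiK).1 (Nat.cast_nonneg _)
  · have hij : i < j := Finset.mem_range.mp hi
    have hiK : i ≤ K := hij.le.trans hj
    have hz := (𝔠.zcoefOf_nonneg_le (T3Scales F γ hγ hγ1' K) i hiK).2
    rw [T3Scales_gk_eq F γ hγ hγ1' K i hiK] at hz
    have hvol : (ZVol 𝔠.lane.carrier.M₁ (rcolOf (T3Scales F γ hγ hγ1' K) 𝔠.lane.carrier) j r i : ℝ) =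
        (({y : Site (F.P K) i | toFine i y ∉ (AlphaInputsT3AC.dataIntRows q π).Ω K j r (i + 1)} : Set (Site (F.P K) i)).ncard : ℝ) :=
      ZVol_eq_ncard _ _ j r i hij (by show i ≤ F.m + K; omega)
    rw [hvol, ← mul_assoc]
    exact mul_le_mul_of_nonneg_right hz (Nat.cast_nonneg _)

end Zterm

end Summit.QuantumFields.YangMills.Theorems

end
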